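import Summits.RiemannHypothesis.RiemannHypothesis.Theorems.DBNKernelMasses
import HarnessLib

/-!
# RiemannHypothesis / DBN — T12 `InteriorProbeMass`, T12′ `InteriorDescentMass` (masses at every height)

RH-FREE real analysis (THEORY-R4 §2 of the `pub-dbn` cell, `Sketch4.lean` sha16 3a8b9a024097398f,
namespace `DbnTheory4`; support-grade, "S-sized if an idle prover wants them").  The two typed
statements are byte-verbatim from the sketch and PROVED here (sorry-free, standard axioms):

* `InteriorProbeMass` (T12): `∫_ℝ S_{c,κ,u}(ξ,η) dξ = 2π` at EVERY height `|η| ≤ 1` (`c > 1`) —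
  generalises T1b `ProbeMass` (the case `η = 1`, `DBNKernelMasses.lean`); same Fubini argument with the
  two Poisson heights `c ∓ η > 0`;
* `InteriorDescentMass` (T12′): `∫_ℝ P(ξ,η) dξ = 4π` for `|η| < 1` — versus `2π` for the regular part
  `4/(ξ²+4)` on the boundary line (`DescentMass`): the corner carries a point mass `2π`, which is why
  integrating hypothesis (K) on an interior line gives only `W ≤ 2` while the ceiling `W ≤ 1` (T1c) is a
  boundary-line fact.

`--supports stmt-RiemannHypothesis-0274`; nothing here bears on the truth of RH.
-/

noncomputable section

-- D-0017: `Summit.<S>.<S>.…` is the designed namespace of a single-problem summit.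
set_option linter.dupNamespace false

open scoped Real
open MeasureTheory Set intervalIntegral

namespace Summit.RiemannHypothesis.RiemannHypothesis.Theorems.DbnTheory

/-- TARGET T12 (RH-FREE, support-grade) — the probe mass is `2π` at EVERY height of the closed strip
(generalises `ProbeMass`, the case `η = 1`).  Verbatim `DbnTheory4.InteriorProbeMass`. -/
def InteriorProbeMass : Prop :=
  ∀ c κ u η : ℝ, 1 < c → |η| ≤ 1 → ∫ ξ, probeKernel c κ u ξ η = 2 * π

/-- TARGET T12′ (RH-FREE) — the descent kernel has mass `4π` on every interior line (vs `2π` for its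
regular part `4/(ξ²+4)` on the boundary line, `DescentMass`): the corner carries a point mass `2π`.
Verbatim `DbnTheory4.InteriorDescentMass`. -/
def InteriorDescentMass : Prop :=
  ∀ η : ℝ, |η| < 1 → ∫ ξ, descentKernel ξ η = 4 * π

section probe

variable {c : ℝ} (κ u : ℝ) {η : ℝ}

/-- For fixed `v`, the `ξ`-section of the height-`η` integrand is integrable with integral `2π·φ(v)`
(`|η| < c`). [folklore] -/
theorem integral_probe_section_eta (h1 : 0 < c - η) (h2 : 0 < c + η) (v : ℝ) :
    Integrable (fun ξ : ℝ => biweight v * ((c - η) / ((c - η)^2 + (ξ - u - κ * v)^2)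
      + (c + η) / ((c + η)^2 + (ξ - u - κ * v)^2))) ∧
    ∫ ξ : ℝ, biweight v * ((c - η) / ((c - η)^2 + (ξ - u - κ * v)^2)
      + (c + η) / ((c + η)^2 + (ξ - u - κ * v)^2)) = biweight v * (2 * π) := by
  have hi := (integrable_poisson_shift h1 u (κ * v)).add (integrable_poisson_shift h2 u (κ * v))
  refine ⟨hi.const_mul _, ?_⟩
  rw [MeasureTheory.integral_const_mul, integral_add (integrable_poisson_shift h1 u (κ * v))
    (integrable_poisson_shift h2 u (κ * v)), integral_poisson_shift h1, integral_poisson_shift h2]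
  ring

/-- Joint integrability of the height-`η` integrand on `ℝ × (-1,1]` (`|η| < c`). [folklore] -/
theorem integrable_probe_prod_eta (h1 : 0 < c - η) (h2 : 0 < c + η) :
    Integrable (fun p : ℝ × ℝ => biweight p.2 * ((c - η) / ((c - η)^2 + (p.1 - u - κ * p.2)^2)
      + (c + η) / ((c + η)^2 + (p.1 - u - κ * p.2)^2)))
      ((volume : Measure ℝ).prod (volume.restrict (Ioc (-1:ℝ) 1))) := by
  have hcont : Continuous (fun p : ℝ × ℝ => biweight p.2 * ((c - η) / ((c - η)^2 + (p.1 - u - κ * p.2)^2)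
      + (c + η) / ((c + η)^2 + (p.1 - u - κ * p.2)^2))) := by
    refine (continuous_biweight.comp continuous_snd).mul (Continuous.add ?_ ?_)
    · exact continuous_const.div (by fun_prop) (fun p => by positivity)
    · exact continuous_const.div (by fun_prop) (fun p => by positivity)
  rw [integrable_prod_iff' hcont.aestronglyMeasurable]
  refine ⟨Filter.Eventually.of_forall fun v => (integral_probe_section_eta κ u h1 h2 v).1, ?_⟩
  have h : (fun v : ℝ => ∫ ξ : ℝ, ‖biweight v * ((c - η) / ((c - η)^2 + (ξ - u - κ * v)^2)
      + (c + η) / ((c + η)^2 + (ξ - u - κ * v)^2))‖) = fun v => biweight v * (2 * π) := by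
    funext v
    rw [← (integral_probe_section_eta κ u h1 h2 v).2]
    congr 1; funext ξ
    rw [Real.norm_of_nonneg]
    have := biweight_nonneg v
    positivity
  rw [h]
  exact ((continuous_biweight.mul continuous_const).integrableOn_Icc).mono_set Ioc_subset_Icc_self

/-- **Mass of the smeared probe at height `η`**: `∫_ℝ S_{c,κ,u}(ξ,η) dξ = 2π` whenever `|η| < c`
(here through `0 < c ∓ η`). [folklore] -/
theorem integral_probeKernel_eta (h1 : 0 < c - η) (h2 : 0 < c + η) :
    ∫ ξ, probeKernel c κ u ξ η = 2 * π := by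
  have hF := integrable_probe_prod_eta κ u h1 h2
  calc ∫ ξ, probeKernel c κ u ξ η
      = ∫ ξ, ∫ v in Ioc (-1:ℝ) 1, biweight v * ((c - η) / ((c - η)^2 + (ξ - u - κ * v)^2)
          + (c + η) / ((c + η)^2 + (ξ - u - κ * v)^2)) := by
        congr 1; funext ξ; rw [probeKernel, intervalIntegral.integral_of_le (by norm_num)]
    _ = ∫ v in Ioc (-1:ℝ) 1, ∫ ξ, biweight v * ((c - η) / ((c - η)^2 + (ξ - u - κ * v)^2)
          + (c + η) / ((c + η)^2 + (ξ - u - κ * v)^2)) := integral_integral_swap hF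
    _ = ∫ v in Ioc (-1:ℝ) 1, biweight v * (2 * π) := by
        congr 1; funext v; exact (integral_probe_section_eta κ u h1 h2 v).2
    _ = (∫ v in (-1:ℝ)..1, biweight v) * (2 * π) := by
        rw [MeasureTheory.integral_mul_const, intervalIntegral.integral_of_le (by norm_num)]
    _ = 2 * π := by rw [integral_biweight, one_mul]

end probe

/-- **`InteriorProbeMass`** (T12). [folklore] -/
theorem InteriorProbeMass_holds : InteriorProbeMass := by
  intro c κ u η hc hη
  obtain ⟨hη1, hη2⟩ := abs_le.mp hη
  exact integral_probeKernel_eta κ u (by linarith) (by linarith)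

/-- **`InteriorDescentMass`** (T12′): `∫ P(·,η) = 2(π + π) = 4π` for `|η| < 1`. [folklore] -/
theorem InteriorDescentMass_holds : InteriorDescentMass := by
  intro η hη
  obtain ⟨hη1, hη2⟩ := abs_lt.mp hη
  have h1 : 0 < 1 - η := by linarith
  have h2 : 0 < 1 + η := by linarith
  unfold descentKernel
  rw [MeasureTheory.integral_const_mul, integral_add (integrable_poisson h1) (integrable_poisson h2),
    integral_poisson h1, integral_poisson h2]
  ring

end Summit.RiemannHypothesis.RiemannHypothesis.Theorems.DbnTheory

end
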